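import Literature.AlgebraicGeometry.HodgeTheory.DefiniteQuaternionRosatiCanonicalInvolution
import Literature.AlgebraicGeometry.HodgeTheory.WeilClassesFieldDefiniteQuaternionCentral
import Literature.AlgebraicGeometry.HodgeTheory.DivisorLefschetzGroupCentreFiniteIffNoTypeIVFactor
import Literature.AlgebraicGeometry.HodgeTheory.HodgeGroupFiniteCentreThetaTrace
import Literature.AlgebraicGeometry.HodgeTheory.WeilClassesFieldCMCentreDichotomy
import Literature.AlgebraicGeometry.HodgeTheory.TimesTypeIIStablyNondegenerateProductSpan
import HarnessLib

/-!
# An abelian variety of Albert type III is NEVER stably nondegenerate: exceptional Weil classes on a simple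
# complex abelian variety with totally definite quaternion multiplication (Murty 1984; Moonen–Zarhin 1998)

Family `hodge`, cell `pub-hodge-ring2` (unit `pub-hodge-ring2-lit-g80`, programme R57 «TYPE III VACUITY»).  HONEST
FRAMING (page 1, verbatim for the cell): research route conditional on HC_CM; not a corollary; Q11.4-sentence-2
already refuted in dim ≥ 3.  Nothing in this file asserts the Hodge conjecture for any variety: it proves that a
HYPOTHESIS of the cell's product theorems — stable nondegeneracy `IsStablyNondegenerate S`, i.e. condition (D)
«`B•(Sⁿ) = D•(Sⁿ)` for all `n`» — FAILS for every complex abelian variety `S` whose endomorphism algebra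
`End⁰(S)` is a totally definite quaternion algebra over a (totally real) number field `K` (Albert type III), so that
the standing hypothesis `IsTotallyIndefinite K End⁰(S)` of the type II rows (`TimesTypeIIStablyNondegenerateProductSpan`)
is not a restriction but a CONSEQUENCE of (D) (§4).

## The printed theorem and its proof

Murty 1984 (= Gordon's survey, Thm. 7.5 (1) ⟹ (2) and §8.6 Theorem): «If an abelian variety `A` has a factor of
type (III), then it supports an exceptional Hodge class» [held text of the survey, arXiv:alg-geom/9709030, p0020
L118–L126 (Thm. 7.5, Def. 7.6) and p0022 L79–L90 (§8.6)].  We formalize the simple case through Moonen–Zarhin's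
criterion for Weil classes [MoonenZarhin1998WeilClasses, §1 Criterion (2), case «`Y` is of Type 3, `m = 1` and
`F ⊄ E`», held text arXiv:alg-geom/9612017 p0003 L59–L90], whose `End(A)`-level form is the tree's
`weilClassesField_inf_divisorClassesSpan_eq_bot_iff_exists_comp_ne_of_definiteQuaternionOver_End`
(`WeilClassesFieldDefiniteQuaternionCentral`): for `S` simple of type III with centre `E = ℚ(ψ)` and `D = E⟨α, β⟩`
(`α, β` Rosati-skew, anticommuting, `α², β² ∈ E`), and `F = ℚ(α) ⊄ E`, the space of Weil classes
`W_F ⊗ ℂ ⊆ H^{2m}(S(ℂ); ℂ)` (`2m [F:ℚ] = 2 dim S`) meets the divisor span `𝒟ᵐ ⊗ ℂ` trivially, while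
`W_F ⊗ ℂ ⊆ Bᵐ ⊗ ℂ` because `Hg(S)` is semisimple (no factor of type IV; the tree's
`weilClassesField_le_hodgeClassSpan_of_hasSemisimpleHodgeGroup` and `MoonenZarhin1999_semisimple_of_hasNoTypeIVFactor_holds`)
and `W_F ≠ 0`.  Hence `Bᵐ(S) ≠ 𝒟ᵐ(S)`: `S` is not divisor-generated, a fortiori not stably nondegenerate.

What this file supplies (all PROVED, no new named fact, D-0026):

* §1–§2  the algebra of the presentation `End⁰(S) ≅ ℍ[K,a,b]` (`a, b` totally negative) pulled back to `End(S)`: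
  integral multiples `α, β ∈ End(S)` of the pure units `i, j` with `α ≫ α = q_a(ψ)`, `β ≫ β = q_b(ψ)` for integer
  polynomials `q_a, q_b` in the central generator `ψ` NON-VANISHING at the roots of its minimal polynomial (the
  eigenvalues of `(α ≫ α)^*` on the `ψ^*`-eigenspaces are the embeddings of `c²a ≠ 0`,
  `exists_embedding_apply_eq_of_eigenvalue_pullbackOne`), `α ≫ β = -(β ≫ α)`, and «`End⁰(S) = E⟨α, β⟩`»: every
  `g ∈ End(S)` has a non-zero integer multiple in `ℤ⟨ψ, α, β⟩` (`forall_exists_zsmul_mem_closure`);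
* §3  the Rosati skewness of `α, β` is the canonical-involution theorem of
  `DefiniteQuaternionRosatiCanonicalInvolution` (`rosati_skew_of_standardInvolution_eq_neg`), the Rosati symmetry
  of `ψ` is `adjoint_eq_iff_hasNoTypeIVFactor`; `F = ℚ(α)` with `P = minpoly_ℤ(α)` irreducible over `ℚ` because
  `End(S) ↪ End⁰(S)` is a domain (a totally definite quaternion algebra over a number field is a division algebra,
  `isUnit_of_isTotallyDefinite_numberField`; hence also `S` is simple, `isSimple_of_forall_exists_mul_eq_one`, and
  `dim S ≥ 1`); the main theorems
  **`exists_hodgeClass_not_mem_divisorClassesSpan_of_isTotallyDefinite`** (an exceptional rational Hodge class on `S`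
  itself), **`not_isDivisorGenerated_of_isTotallyDefinite`** (`B•(S) ≠ D•(S)`) and
  **`not_isStablyNondegenerate_of_isTotallyDefinite`** (Murty: type III ⟹ not stably nondegenerate);
* §4  consequences for the cell: **`isTotallyIndefinite_of_isDivisorGenerated_of_hasNoTypeIVFactor`** — a SIMPLE
  divisor-generated `S` with quaternion `End⁰(S)` over a number field `K` and no factor of type IV is of type II
  (`K` totally real, `End⁰(S)` totally indefinite: Albert's dichotomy `isAlbertTypeII_or_isAlbertTypeIII_of_isPositiveAntiInvolution`
  for the Rosati involution, type III being excluded by §3), and the type II product rows WITHOUT their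
  `IsTotallyIndefinite`/`IsTotallyReal` hypotheses: **`IsStablyNondegenerate.prod_of_isSimple_quaternion_right/left`**.

Not claimed: Murty's statement for a non-simple `A` with a type III FACTOR (it follows from the simple case and
Hazama's Remark 7.6.1 «an abelian subvariety of a stably nondegenerate variety is stably nondegenerate» only for the
`IsStablyNondegenerate` form; the tree has `IsStablyNondegenerate.of_isIsogenous` and `.of_powSucc` but not yet the
passage to a factor, which is not needed by the cell), nor the equivalence (1) ⟺ (2) ⟺ (3) of Thm. 7.5, nor the
divisibility `π₁^*ω ⊗ π₂^*ω ∈ Div(A²)`.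

## References

* [Murty1984] V. Kumar Murty, *Exceptional Hodge classes on certain abelian varieties*, Math. Ann. **268** (1984)
  197–206 — the theorem as reported in [Gordon1999HodgeAVSurvey, Thm. 7.5 and §8.6]. [cite: Murty1984, Main Theorem (via Gordon1999HodgeAVSurvey, Thm. 7.5 and §8.6 Theorem)]
* [Gordon1999HodgeAVSurvey] B. B. Gordon, *A survey of the Hodge conjecture for abelian varieties* (Appendix B to
  Lewis' book), arXiv:alg-geom/9709030: Thm. 7.5, Def. 7.6, Rem. 7.6.1, §8.6 (held p0020–p0022).
  [cite: Gordon1999HodgeAVSurvey, Thm. 7.5, Def. 7.6 and §8.6]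
* [MoonenZarhin1998WeilClasses] B. Moonen, Yu. Zarhin, *Weil classes on abelian varieties*, J. reine angew. Math.
  **496** (1998), §1 Criterion (2) (held arXiv text p0003 L59–L90). [cite: MoonenZarhin1998WeilClasses, §1 Criterion (2), «Y is of Type 3, m = 1 and F ⊄ E»]
* [MoonenZarhin1999LowDim] B. Moonen, Yu. Zarhin, Math. Ann. **315** (1999), §1 (no type IV ⟹ `Hg` semisimple), §2
  condition (D). [cite: MoonenZarhin1999LowDim, §1 and §2 (D)]
* [Lange2023AbelianVarietiesComplex] H. Lange, *Abelian Varieties over the Complex Numbers* (2023), §2.6.1–§2.6.2,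
  Thm. 2.6.5 (held p0138, p0141–p0142: the Rosati involution on type III is `x ↦ x̄`). [cite: Lange2023AbelianVarietiesComplex, §2.6.2 Thm. 2.6.5]
* [MumfordAV1970] D. Mumford, *Abelian Varieties*, §19 Thm. 3 and Cor. 2 of Thm. 1, §21 Thm. 2. [cite: MumfordAV1970, §19 Thm. 3, §21 Thm. 2]
* [VignerasLNM800] M.-F. Vignéras, *Arithmétique des algèbres de quaternions*, LNM 800, Ch. I §1, Ch. III §4 Thm. 4.1.
  [cite: VignerasLNM800, Ch. I §1 and Ch. III Thm. 4.1]
-/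

noncomputable section

open CategoryTheory Module Polynomial NumberField
open scoped TensorProduct Quaternion
open Literature.AlgebraicTopology.SingularHomology
open Literature.AlgebraicGeometry.Motives
open Literature.AlgebraicGeometry.VanGeemen1994 (pullbackOne hodgeClassSpan)
open Literature.AlgebraicGeometry.Milne1999
open Literature.Geometry.Kaehler (HasHardLefschetzProperty lefschetzPow)
open Literature.Barriers.HodgeConjecture (divisorClassesSpan)
open Literature.AlgebraicGeometry.Motives.HodgeStructure
open Literature.AlgebraicGeometry.ComplexMultiplication
open Literature.NumberTheory.Automorphic (IsQuaternionAlgebra IsTotallyDefinite standardInvolution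
  standardInvolution_algEquiv standardInvolution_quaternionAlgebra isTotallyReal_of_isTotallyDefinite_holds)
open Literature.RingTheory.CentralSimple

namespace Literature.AlgebraicGeometry.HodgeTheory

/-! ### §1 `End(S) ↪ End⁰(S)`: integer polynomials in `ψ`, central multiples, integral multiples -/

section EndLevel

variable {S : AbelianVariety ℂ}

/-- An element of the subring `ℤ[ψ] ⊆ End(S)` is an integer polynomial in `ψ`. [folklore] -/
private theorem exists_eq_eval₂_of_mem_closure_singleton {x ψ : CategoryTheory.End S}
    (hx : x ∈ Subring.closure ({ψ} : Set (CategoryTheory.End S))) :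
    ∃ q : Polynomial ℤ, x = Polynomial.eval₂ (Int.castRingHom (CategoryTheory.End S)) ψ q := by
  have hx' : x ∈ (Algebra.adjoin ℤ ({ψ} : Set (CategoryTheory.End S))).toSubring :=
    (Subring.closure_le.2 fun y hy ↦ Algebra.subset_adjoin hy) hx
  rw [Subalgebra.mem_toSubring, Algebra.adjoin_singleton_eq_range_aeval, AlgHom.mem_range] at hx'
  obtain ⟨q, hq⟩ := hx'
  exact ⟨q, by rw [← hq, Polynomial.aeval_def,
    RingHom.ext_int (algebraMap ℤ (CategoryTheory.End S)) (Int.castRingHom (CategoryTheory.End S))]⟩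

/-- `g ≫ c = c ≫ g` for every `g` as soon as `1 ⊗ c` is central in `End⁰(S)` (`End(S) ↪ End⁰(S)`,
Mumford §19 Thm. 3). [folklore] -/
private theorem comp_comm_of_of_mem_center' {c : S ⟶ S}
    (hc : AbelianVariety.endAlgebra.of S c ∈ Subalgebra.center ℚ S.endAlgebra) (g : S ⟶ S) : g ≫ c = c ≫ g := by
  apply AbelianVariety.endAlgebra.of_injective_of_charZero (A := S)
  change AbelianVariety.endAlgebra.of S (End.of c * End.of g) = AbelianVariety.endAlgebra.of S (End.of g * End.of c)
  rw [map_mul, map_mul]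
  exact ((Subalgebra.mem_center_iff.1 hc) _).symm

/-- `1 ⊗ (N • F) = N • (1 ⊗ F)` for the `Hom`-level multiple. [folklore] -/
private theorem of_zsmul' (N : ℤ) (F : S ⟶ S) :
    AbelianVariety.endAlgebra.of S (N • F) = N • AbelianVariety.endAlgebra.of S F :=
  map_zsmul (AbelianVariety.endAlgebra.of S) N (End.of F)

variable {K : Type} [Field K] [NumberField K] [Algebra K S.endAlgebra] [IsScalarTower ℚ K S.endAlgebra]

/-- Every `z ∈ End⁰(S) = ℚ ⊗ End(S)` has a non-zero integer multiple `c • z = 1 ⊗ F` in `End(S)`. [folklore] -/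
private theorem exists_of_eq_int_smul (z : S.endAlgebra) :
    ∃ (c : ℤ) (F : S ⟶ S), c ≠ 0 ∧ AbelianVariety.endAlgebra.of S F = (c : K) • z := by
  obtain ⟨M, F, hM, hF⟩ := AbelianVariety.endAlgebra.exists_eq_algebraMap_mul_of z
  have hM0 : (M : ℚ) ≠ 0 := Nat.cast_ne_zero.2 hM
  refine ⟨M, F, by exact_mod_cast hM, ?_⟩
  calc AbelianVariety.endAlgebra.of S F
      = algebraMap ℚ S.endAlgebra M * (algebraMap ℚ S.endAlgebra (M : ℚ)⁻¹ * AbelianVariety.endAlgebra.of S F) := by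
        rw [← mul_assoc, ← map_mul, mul_inv_cancel₀ hM0, map_one, one_mul]
    _ = ((M : ℤ) : K) • z := by
        rw [← hF, ← Algebra.smul_def, Int.cast_natCast, ← map_natCast (algebraMap ℚ K) M, algebraMap_smul]

/-- **CENTRAL ELEMENTS OF `K` HAVE MULTIPLES IN `ℤ[ψ]`**: for `k ∈ K` (central in `End⁰(S)`) there are `N ≠ 0` and
`G ∈ ℤ[ψ] ⊆ End(S)` with `1 ⊗ G = algebraMap (N k)` — the presentation «`E = ℚ(ψ)`» of the centre (`hZ`).
[cite: MoonenZarhin1998WeilClasses, §1 («E the center of D»)] [cite: MumfordAV1970, §19 Thm. 3] -/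
private theorem exists_mem_closure_of_eq_algebraMap {ψ : S ⟶ S}
    (hZ : ∀ g : S ⟶ S, (∀ χ : S ⟶ S, g ≫ χ = χ ≫ g) →
      ∃ N : ℤ, N ≠ 0 ∧ End.of (N • g) ∈ Subring.closure {End.of ψ})
    (k : K) : ∃ (N : ℤ) (G : S ⟶ S), N ≠ 0 ∧ End.of G ∈ Subring.closure {End.of ψ} ∧
      AbelianVariety.endAlgebra.of S G = algebraMap K S.endAlgebra ((N : K) * k) := by
  obtain ⟨c, F, hc, hF⟩ := exists_of_eq_int_smul (K := K) (algebraMap K S.endAlgebra k)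
  rw [Algebra.smul_def, ← map_mul] at hF
  have hFc : ∀ χ : S ⟶ S, F ≫ χ = χ ≫ F := fun χ ↦ (comp_comm_of_of_mem_center' (by
    rw [hF, Subalgebra.mem_center_iff]; exact fun b ↦ (Algebra.commutes _ b).symm) χ).symm
  obtain ⟨N, hN, hmem⟩ := hZ F hFc
  refine ⟨N * c, N • F, mul_ne_zero hN hc, hmem, ?_⟩
  rw [of_zsmul', hF, zsmul_eq_mul, ← map_intCast (algebraMap K S.endAlgebra) N, ← map_mul, Int.cast_mul, mul_assoc]

/-- **INTEGRAL PURE GENERATORS WITH CENTRAL SQUARE IN `ℤ[ψ]`, NON-VANISHING AT THE ROOTS.**  For `z ∈ End⁰(S)` with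
`z² = t ∈ K`, `t ≠ 0` (a pure unit `i` or `j` of a quaternion basis), and the centre presented as `ℚ(ψ)` on
`End(S)` (`R(ψ) = 0`, `R` monic irreducible over `ℚ`; every central `g` with `N g ∈ ℤ[ψ]`): there are `c ≠ 0`,
`α ∈ End(S)` with `1 ⊗ α = c • z` and `q ∈ ℤ[X]` with `α ≫ α = q(ψ)` and `q(w) ≠ 0` at every complex root `w`
of `R` — on a `ψ^*`-eigenvector `v ∈ ker(ψ^* - w)` (non-zero: `dim V_w · deg R = 2 dim S > 0`) one has
`(α ≫ α)^* v = q(w) v`, and the eigenvalues of `(α ≫ α)^* = (1 ⊗ c²t)^*` are the embeddings `φ(c²t) ≠ 0`.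
«`α² = a ∈ E^×`» of the type-3 presentation `D = E⟨α, β⟩`.
[cite: MoonenZarhin1998WeilClasses, §1 Criterion (2), type 3 (chunk p0003 L59–L90)] [cite: MumfordAV1970, §19 Thm. 3] -/
private theorem exists_pure_generator (h1 : 1 ≤ S.dim) {ψ : S ⟶ S} {R : Polynomial ℤ} (hRm : R.Monic)
    (hRirr : Irreducible (R.map (Int.castRingHom ℚ)))
    (hψR : Polynomial.eval₂ (Int.castRingHom (CategoryTheory.End S)) (ψ : CategoryTheory.End S) R = 0)
    (hZ : ∀ g : S ⟶ S, (∀ χ : S ⟶ S, g ≫ χ = χ ≫ g) →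
      ∃ N : ℤ, N ≠ 0 ∧ End.of (N • g) ∈ Subring.closure {End.of ψ})
    (z : S.endAlgebra) {t : K} (hzt : z * z = algebraMap K S.endAlgebra t) (ht : t ≠ 0) :
    ∃ (c : ℤ) (α : S ⟶ S) (qa : Polynomial ℤ), c ≠ 0 ∧ AbelianVariety.endAlgebra.of S α = (c : K) • z ∧
      α ≫ α = Polynomial.eval₂ (Int.castRingHom (CategoryTheory.End S)) (ψ : CategoryTheory.End S) qa ∧
      ∀ w : ℂ, (R.map (Int.castRingHom ℂ)).IsRoot w → (qa.map (Int.castRingHom ℂ)).eval w ≠ 0 := by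
  obtain ⟨c, F, hc, hF⟩ := exists_of_eq_int_smul (K := K) z
  -- squares of integral multiples of `z` are central: `1 ⊗ (G ≫ G) = algebraMap (d² t)`
  have hsq : ∀ (G : S ⟶ S) (d : ℤ), AbelianVariety.endAlgebra.of S G = (d : K) • z →
      AbelianVariety.endAlgebra.of S (G ≫ G) = algebraMap K S.endAlgebra ((d : K) ^ 2 * t) := by
    intro G d hG
    change AbelianVariety.endAlgebra.of S (End.of G * End.of G) = _
    rw [map_mul]
    change AbelianVariety.endAlgebra.of S G * AbelianVariety.endAlgebra.of S G = _
    rw [hG, smul_mul_smul_comm, hzt, Algebra.smul_def, ← map_mul, sq]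
  have hFFc : ∀ χ : S ⟶ S, (F ≫ F) ≫ χ = χ ≫ (F ≫ F) := fun χ ↦ (comp_comm_of_of_mem_center' (by
    rw [hsq F c hF, Subalgebra.mem_center_iff]; exact fun b ↦ (Algebra.commutes _ b).symm) χ).symm
  obtain ⟨N, hN, hmem⟩ := hZ (F ≫ F) hFFc
  obtain ⟨q, hq⟩ := exists_eq_eval₂_of_mem_closure_singleton hmem
  have hq' : N • (F ≫ F) = Polynomial.eval₂ (Int.castRingHom (CategoryTheory.End S)) (ψ : CategoryTheory.End S) q :=
    hq
  set α : S ⟶ S := N • F with hαdef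
  have hofα : AbelianVariety.endAlgebra.of S α = ((N * c : ℤ) : K) • z := by
    rw [hαdef, of_zsmul', hF, zsmul_eq_mul, Algebra.smul_def, Algebra.smul_def, ← mul_assoc,
      ← map_intCast (algebraMap K S.endAlgebra) N, ← map_mul, Int.cast_mul]
  have hα2 : α ≫ α = Polynomial.eval₂ (Int.castRingHom (CategoryTheory.End S)) (ψ : CategoryTheory.End S) (N • q) := by
    rw [Polynomial.eval₂_smul, ← hq', hαdef, Preadditive.zsmul_comp, Preadditive.comp_zsmul, eq_intCast,
      ← zsmul_eq_mul]
    rfl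
  refine ⟨N * c, α, N • q, mul_ne_zero hN hc, hofα, hα2, fun w hw ↦ ?_⟩
  have hwR : Polynomial.eval₂ (Int.castRingHom ℂ) w R = 0 := by
    rwa [Polynomial.IsRoot.def, Polynomial.eval_map] at hw
  -- a non-zero `ψ^*`-eigenvector for `w`
  haveI := finite_complexBetti_abelianVariety S 1
  have hpos : 0 < Module.finrank ℂ (Module.End.eigenspace (pullbackOne S ψ) w) := by
    rcases Nat.eq_zero_or_pos (Module.finrank ℂ (Module.End.eigenspace (pullbackOne S ψ) w)) with h0 | h0
    · exfalso
      have hfin := finrank_eigenspace_mul_natDegree_eq hRm hRirr hψR hwR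
      have h0' : Module.finrank ℂ (Module.End.eigenspace (complexBetti.map ψ.hom.hom.hom 1).hom w) = 0 := h0
      rw [h0', zero_mul] at hfin
      omega
    · exact h0
  obtain ⟨⟨v, hvmem⟩, hvne⟩ := Module.finrank_pos_iff_exists_ne_zero.1 hpos
  have hv0 : v ≠ 0 := fun h ↦ hvne (Subtype.ext h)
  have hvec : Module.End.HasEigenvector (pullbackOne S ψ) w v := ⟨hvmem, hv0⟩
  have hμ : pullbackOne S (α ≫ α) v = (((N • q).map (Int.castRingHom ℂ)).eval w) • v := by
    rw [hα2, pullbackOne_eval₂, Module.End.aeval_apply_of_hasEigenvector hvec]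
  obtain ⟨φ, hφ⟩ := exists_embedding_apply_eq_of_eigenvalue_pullbackOne (α ≫ α) _ (hsq α (N * c) hofα) hv0 hμ
  rw [← hφ]
  exact (map_ne_zero φ).2 (mul_ne_zero (pow_ne_zero _ (Int.cast_ne_zero.2 (mul_ne_zero hN hc))) ht)

/-- **«`End⁰(S) = E⟨α, β⟩`» ON `End(S)`**: if `End⁰(S) ≅ ℍ[K,a,b]` with `1 ⊗ α ↦ cα i`, `1 ⊗ β ↦ cβ j`
(`cα, cβ ≠ 0` integers) and every `k ∈ K` has a multiple in `ℤ[ψ]`, then every `g ∈ End(S)` has a non-zero integer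
multiple in the subring `ℤ⟨ψ, α, β⟩`: writing `1 ⊗ g = x₀ + x₁ i + x₂ j + x₃ ij` (`xᵢ ∈ K`) and clearing the
denominators of the `xᵢ` and of `i = cα⁻¹ (1 ⊗ α)`, `j = cβ⁻¹ (1 ⊗ β)`. The hypothesis `hD` of the `End(A)`-level
type-3 row. [cite: MoonenZarhin1998WeilClasses, §1 («D = E⟨α, β⟩», Criterion (2) type 3)] [cite: MumfordAV1970, §19 Thm. 3] -/
private theorem forall_exists_zsmul_mem_closure {ψ α β : S ⟶ S} {a b : K}
    (hZ : ∀ g : S ⟶ S, (∀ χ : S ⟶ S, g ≫ χ = χ ≫ g) →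
      ∃ N : ℤ, N ≠ 0 ∧ End.of (N • g) ∈ Subring.closure {End.of ψ})
    (e : S.endAlgebra ≃ₐ[K] ℍ[K,a,b]) {cα cβ : ℤ} (hcα : cα ≠ 0) (hcβ : cβ ≠ 0)
    (hα : e (AbelianVariety.endAlgebra.of S (End.of α)) = ⟨0, cα, 0, 0⟩)
    (hβ : e (AbelianVariety.endAlgebra.of S (End.of β)) = ⟨0, 0, cβ, 0⟩) :
    ∀ g : S ⟶ S, ∃ N : ℤ, N ≠ 0 ∧ End.of (N • g) ∈ Subring.closure {End.of ψ, End.of α, End.of β} := by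
  intro g
  set y : ℍ[K,a,b] := e (AbelianVariety.endAlgebra.of S g) with hy
  obtain ⟨N₀, G₀, hN₀, hG₀m, hG₀⟩ := exists_mem_closure_of_eq_algebraMap hZ y.re
  obtain ⟨N₁, G₁, hN₁, hG₁m, hG₁⟩ := exists_mem_closure_of_eq_algebraMap hZ y.imI
  obtain ⟨N₂, G₂, hN₂, hG₂m, hG₂⟩ := exists_mem_closure_of_eq_algebraMap hZ y.imJ
  obtain ⟨N₃, G₃, hN₃, hG₃m, hG₃⟩ := exists_mem_closure_of_eq_algebraMap hZ y.imK
  have heG : ∀ {G : S ⟶ S} {x : K}, AbelianVariety.endAlgebra.of S G = algebraMap K S.endAlgebra x →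
      e (AbelianVariety.endAlgebra.of S (End.of G)) = ⟨x, 0, 0, 0⟩ := fun {G x} hG ↦ by
    change e (AbelianVariety.endAlgebra.of S G) = _
    rw [hG, AlgEquiv.commutes, QuaternionAlgebra.algebraMap_eq]
  have hsub : Subring.closure ({End.of ψ} : Set (CategoryTheory.End S)) ≤
      Subring.closure {End.of ψ, End.of α, End.of β} :=
    Subring.closure_mono (Set.singleton_subset_iff.2 (Set.mem_insert _ _))
  have hαm : End.of α ∈ Subring.closure ({End.of ψ, End.of α, End.of β} : Set (CategoryTheory.End S)) :=
    Subring.subset_closure (Set.mem_insert_of_mem _ (Set.mem_insert _ _))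
  have hβm : End.of β ∈ Subring.closure ({End.of ψ, End.of α, End.of β} : Set (CategoryTheory.End S)) :=
    Subring.subset_closure (Set.mem_insert_of_mem _ (Set.mem_insert_of_mem _ (Set.mem_singleton _)))
  refine ⟨N₀ * N₁ * N₂ * N₃ * cα * cβ,
    mul_ne_zero (mul_ne_zero (mul_ne_zero (mul_ne_zero (mul_ne_zero hN₀ hN₁) hN₂) hN₃) hcα) hcβ, ?_⟩
  have key : End.of ((N₀ * N₁ * N₂ * N₃ * cα * cβ) • g) =
      (N₁ * N₂ * N₃ * cα * cβ) • End.of G₀ +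
        (N₀ * N₂ * N₃ * cβ) • (End.of G₁ * End.of α) +
        (N₀ * N₁ * N₃ * cα) • (End.of G₂ * End.of β) +
        (N₀ * N₁ * N₂) • (End.of G₃ * End.of α * End.of β) := by
    apply AbelianVariety.endAlgebra.of_injective_of_charZero (A := S)
    apply e.injective
    change e (AbelianVariety.endAlgebra.of S ((N₀ * N₁ * N₂ * N₃ * cα * cβ) • g)) = _
    rw [of_zsmul', map_zsmul, ← hy]
    simp only [map_add, map_mul, map_zsmul, heG hG₀, heG hG₁, heG hG₂, heG hG₃, hα, hβ]
    ext <;> simp <;> ring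
  rw [key]
  exact add_mem (add_mem (add_mem (zsmul_mem (hsub hG₀m) _) (zsmul_mem (mul_mem (hsub hG₁m) hαm) _))
    (zsmul_mem (mul_mem (hsub hG₂m) hβm) _)) (zsmul_mem (mul_mem (mul_mem (hsub hG₃m) hαm) hβm) _)

/-- A monic polynomial irreducible over `ℚ` has a complex root. [folklore] -/
private theorem exists_complex_root' {P : Polynomial ℤ} (hPirr : Irreducible (P.map (Int.castRingHom ℚ))) :
    ∃ ρ : ℂ, Polynomial.eval₂ (Int.castRingHom ℂ) ρ P = 0 := by
  have hdeg : 0 < (P.map (Int.castRingHom ℂ)).degree := by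
    rw [degree_map_eq_of_injective (RingHom.injective_int (Int.castRingHom ℂ)),
      ← degree_map_eq_of_injective (RingHom.injective_int (Int.castRingHom ℚ))]
    exact degree_pos_of_irreducible hPirr
  obtain ⟨z, hz⟩ := Complex.exists_root hdeg
  exact ⟨z, by rwa [IsRoot.def, Polynomial.eval_map] at hz⟩

end EndLevel

/-! ### §3 Type III: exceptional Weil classes on `S` itself; `S` is not stably nondegenerate -/

section TypeIII

variable (S : AbelianVariety ℂ) {K : Type} [Field K] [NumberField K] [Algebra K S.endAlgebra]
  [IsScalarTower ℚ K S.endAlgebra] [IsQuaternionAlgebra K S.endAlgebra]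

/-- **A TYPE III ABELIAN VARIETY CARRIES AN EXCEPTIONAL HODGE CLASS** (Murty 1984; Moonen–Zarhin 1998 Criterion (2),
«`Y` of Type 3, `m = 1`, `F ⊄ E`»).  If `End⁰(S)` is a totally definite quaternion algebra over a number field `K`,
then for some `m` there is a rational class of Hodge type `(m, m)` on `S` outside the `ℂ`-span of products of
divisor classes: with `End⁰(S) = E⟨α, β⟩` as in §1–§2 (`α, β` Rosati-skew by
`rosati_skew_of_standardInvolution_eq_neg`, `ψ` Rosati-symmetric by `adjoint_eq_iff_hasNoTypeIVFactor`) and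
`F = ℚ(α) ⊄ E` (`β` does not commute with `α`), `W_F ⊗ ℂ ⊓ 𝒟ᵐ ⊗ ℂ = ⊥`
(`weilClassesField_inf_divisorClassesSpan_eq_bot_iff_exists_comp_ne_of_definiteQuaternionOver_End`) while
`0 ≠ W_F ⊗ ℂ ⊆ Bᵐ ⊗ ℂ` (`Hg(S)` semisimple: no type IV).
[cite: Murty1984, Main Theorem (via Gordon1999HodgeAVSurvey, Thm. 7.5 and §8.6 Theorem)]
[cite: MoonenZarhin1998WeilClasses, §1 Criterion (2), «Y is of Type 3, m = 1 and F ⊄ E» (chunk p0003 L59–L90)]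
[cite: Gordon1999HodgeAVSurvey, §8.6 Theorem] -/
theorem exists_hodgeClass_not_mem_divisorClassesSpan_of_isTotallyDefinite (hdef : IsTotallyDefinite K S.endAlgebra) :
    ∃ (m : ℕ) (c : complexBetti S.X (2 * m)), IsRationalClass c ∧ IsOfHodgeType S.dim S.X (2 * m) m m c ∧
      c ∉ divisorClassesSpan S.X S.dim m := by
  classical
  -- `End⁰(S)` is a division algebra: `S` is simple, `End(S)` is a domain, `dim S ≥ 1`
  have hdiv : ∀ x : S.endAlgebra, x ≠ 0 → IsUnit x := fun x hx ↦
    isUnit_of_isTotallyDefinite_numberField K S.endAlgebra hdef hx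
  have hS : S.IsSimple := AbelianVariety.isSimple_of_forall_exists_mul_eq_one fun x hx ↦ by
    obtain ⟨u, rfl⟩ := hdiv x hx
    exact ⟨↑u⁻¹, u.mul_inv⟩
  haveI : Nontrivial S.endAlgebra := Module.nontrivial_of_finrank_pos (R := K)
    (by rw [IsQuaternionAlgebra.finrank_eq_four (K := K) (D := S.endAlgebra)]; norm_num)
  haveI : NoZeroDivisors S.endAlgebra := ⟨fun {x y} hxy ↦ by
    by_cases hx : x = 0
    · exact Or.inl hx
    · obtain ⟨u, rfl⟩ := hdiv x hx
      exact Or.inr (by simpa using congrArg (fun w ↦ (↑u⁻¹ : S.endAlgebra) * w) hxy)⟩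
  haveI : Nontrivial (CategoryTheory.End S) := (AbelianVariety.endAlgebra.of S).domain_nontrivial
  haveI : NoZeroDivisors (CategoryTheory.End S) :=
    (AbelianVariety.endAlgebra.of_injective_of_charZero (A := S)).noZeroDivisors _ (map_zero _) (map_mul _)
  haveI : IsDomain (CategoryTheory.End S) := NoZeroDivisors.to_isDomain _
  have h1 : 1 ≤ S.dim := by
    by_contra h0
    have hdim : S.dim = 0 := by omega
    have h10 : (1 : CategoryTheory.End S) = 0 :=
      End.one_def.trans (AbelianVariety.hom_eq_zero_of_dim_eq_zero_left S hdim _)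
    exact one_ne_zero h10
  -- no type IV, semisimple Hodge group, `Θ`-trace condition
  haveI : IsTotallyReal K := isTotallyReal_of_isTotallyDefinite_holds K S.endAlgebra hdef
  have hIV : HasNoTypeIVFactor S := AbelianVariety.hasNoTypeIVFactor_of_isTotallyReal (A := S) (K := K)
  have hSS : HasSemisimpleHodgeGroup S := MoonenZarhin1999_semisimple_of_hasNoTypeIVFactor_holds S hIV
  have hT : HodgeThetaTraceCondition S := hodgeThetaTraceCondition_of_hasSemisimpleHodgeGroup S hSS
  -- a polarization class and the presentation `E = ℚ(ψ)` of the centre on `End(S)`; `ψ` is Rosati-symmetric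
  obtain ⟨h, ψ, ψ', R, hQ, h11, hHL, hposQ, hh, htop, hnd, hψc, hRm, hRirr, hψR, -, hZ, hadj, -, hψ'E⟩ :=
    exists_polarizationClass_centre_presentation_End_with_rosati_of_isSimple hS h1
  have hψ'ψ : ψ' = ψ := (adjoint_eq_iff_hasNoTypeIVFactor h1 hnd hposQ hψc hRm hRirr hψR hadj hψ'E hZ).2 hIV
  subst hψ'ψ
  -- `End⁰(S) ≅ ℍ[K,a,b]`, `a, b` totally negative; the pure units `i`, `j`
  obtain ⟨a, b, ha, hb, -, ⟨e⟩⟩ := exists_algEquiv_quaternionAlgebra_totallyNeg_of_isTotallyDefinite K S.endAlgebra hdef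
  set qi : S.endAlgebra := e.symm ⟨0, 1, 0, 0⟩ with hqi
  set qj : S.endAlgebra := e.symm ⟨0, 0, 1, 0⟩ with hqj
  have hii : qi * qi = algebraMap K S.endAlgebra a := by
    rw [hqi, ← map_mul, show (⟨0, 1, 0, 0⟩ : ℍ[K,a,b]) * ⟨0, 1, 0, 0⟩ = algebraMap K ℍ[K,a,b] a by
      rw [QuaternionAlgebra.algebraMap_eq]; ext <;> simp, AlgEquiv.commutes]
  have hjj : qj * qj = algebraMap K S.endAlgebra b := by
    rw [hqj, ← map_mul, show (⟨0, 0, 1, 0⟩ : ℍ[K,a,b]) * ⟨0, 0, 1, 0⟩ = algebraMap K ℍ[K,a,b] b by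
      rw [QuaternionAlgebra.algebraMap_eq]; ext <;> simp, AlgEquiv.commutes]
  -- integral multiples `α, β ∈ End(S)` with central squares `q_a(ψ), q_b(ψ)` non-vanishing at the roots of `R`
  obtain ⟨cα, α, qa, hcα, hofα, hα2, hqa⟩ := exists_pure_generator h1 hRm hRirr hψR hZ qi hii ha
  obtain ⟨cβ, β, qb, hcβ, hofβ, hβ2, hqb⟩ := exists_pure_generator h1 hRm hRirr hψR hZ qj hjj hb
  have heα : e (AbelianVariety.endAlgebra.of S α) = ⟨0, (cα : K), 0, 0⟩ := by
    rw [hofα, map_smul, hqi, AlgEquiv.apply_symm_apply]; ext <;> simp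
  have heβ : e (AbelianVariety.endAlgebra.of S β) = ⟨0, 0, (cβ : K), 0⟩ := by
    rw [hofβ, map_smul, hqj, AlgEquiv.apply_symm_apply]; ext <;> simp
  have heα' : e (AbelianVariety.endAlgebra.of S (End.of α)) = ⟨0, (cα : K), 0, 0⟩ := heα
  have heβ' : e (AbelianVariety.endAlgebra.of S (End.of β)) = ⟨0, 0, (cβ : K), 0⟩ := heβ
  -- `α β = -β α`
  have hanti : α ≫ β = -(β ≫ α) := by
    apply AbelianVariety.endAlgebra.of_injective_of_charZero (A := S)
    apply e.injective
    change e (AbelianVariety.endAlgebra.of S (End.of β * End.of α)) =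
      e (AbelianVariety.endAlgebra.of S (-(End.of α * End.of β)))
    rw [map_neg, map_neg, map_mul, map_mul, map_mul, map_mul, heα', heβ']
    ext <;> simp [mul_comm]
  -- pure quaternions are Rosati-skew (the Rosati involution is the canonical involution)
  have hstd : ∀ {x : S.endAlgebra} {u v w : K}, e x = ⟨0, u, v, w⟩ → standardInvolution K S.endAlgebra x = -x := by
    intro x u v w hx
    apply e.injective
    rw [← standardInvolution_algEquiv e, hx, standardInvolution_quaternionAlgebra, map_neg, hx]
    ext <;> simp
  have hαskew := rosati_skew_of_standardInvolution_eq_neg h1 hQ h11 hHL hposQ hdef (hstd heα)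
  have hβskew := rosati_skew_of_standardInvolution_eq_neg h1 hQ h11 hHL hposQ hdef (hstd heβ)
  -- «`End⁰(S) = E⟨α, β⟩`» on `End(S)`
  have hD := forall_exists_zsmul_mem_closure hZ e hcα hcβ heα' heβ'
  -- `F = ℚ(α)`: `P = minpoly_ℤ(α)`, irreducible over `ℚ` (`End(S)` is a domain), `P(α) = 0`
  letI : Algebra ℤ (CategoryTheory.End S) := Ring.toIntAlgebra _
  haveI : @Module.Finite ℤ (CategoryTheory.End S) _ _ (AddCommGroup.toIntModule _) :=
    AbelianVariety.module_finite_hom_holds S S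
  have hint : IsIntegral ℤ (End.of α) := IsIntegral.of_finite ℤ _
  set P : Polynomial ℤ := minpoly ℤ (End.of α) with hP
  have hPm : P.Monic := minpoly.monic hint
  have hPirr : Irreducible (P.map (Int.castRingHom ℚ)) := by
    rw [← algebraMap_int_eq]
    exact hPm.irreducible_iff_irreducible_map_fraction_map.1 (minpoly.irreducible hint)
  have hφ : Polynomial.eval₂ (Int.castRingHom (CategoryTheory.End S)) (α : CategoryTheory.End S) P = 0 := by
    have h0 : Polynomial.aeval (End.of α) P = 0 := minpoly.aeval ℤ _
    rwa [Polynomial.aeval_def,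
      RingHom.ext_int (algebraMap ℤ (CategoryTheory.End S)) (Int.castRingHom (CategoryTheory.End S))] at h0
  obtain ⟨ρ, hρ⟩ := exists_complex_root' hPirr
  have her : P.natDegree * (2 * eigenMultiplicity S α ρ) = 2 * S.dim :=
    natDegree_mul_two_mul_eigenMultiplicity_eq_of_hodgeThetaTraceCondition hT hPm hPirr hφ hρ
  -- `F ⊄ E`: `β` does not commute with `α`
  have hnc : ∃ g : S ⟶ S, g ≫ α ≠ α ≫ g := by
    refine ⟨β, fun hc ↦ ?_⟩
    have h2 : α ≫ β = -(α ≫ β) := by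
      calc α ≫ β = -(β ≫ α) := hanti
        _ = -(α ≫ β) := by rw [hc]
    have h0 : AbelianVariety.endAlgebra.of S (End.of β * End.of α) = 0 := by
      have h3 := congrArg (fun f : S ⟶ S ↦ AbelianVariety.endAlgebra.of S (End.of f)) h2
      change AbelianVariety.endAlgebra.of S (End.of β * End.of α) =
        AbelianVariety.endAlgebra.of S (-(End.of β * End.of α)) at h3
      rw [map_neg] at h3
      have h4 : (2 : ℚ) • AbelianVariety.endAlgebra.of S (End.of β * End.of α) = 0 := by
        rw [two_smul]
        exact eq_neg_iff_add_eq_zero.1 h3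
      exact (smul_eq_zero.1 h4).resolve_left two_ne_zero
    rw [map_mul] at h0
    rcases mul_eq_zero.1 h0 with h4 | h4
    · have h5 := congrArg QuaternionAlgebra.imJ (congrArg e h4)
      rw [heβ', map_zero] at h5
      exact hcβ (by simpa using h5)
    · have h5 := congrArg QuaternionAlgebra.imI (congrArg e h4)
      rw [heα', map_zero] at h5
      exact hcα (by simpa using h5)
  -- Moonen–Zarhin: every non-zero Weil class for `F` is exceptional; `W_F ≠ 0`, `W_F ⊆ Bᵐ`
  have hbot := (weilClassesField_inf_divisorClassesSpan_eq_bot_iff_exists_comp_ne_of_definiteQuaternionOver_End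
    h1 hh htop hnd hadj hRm hRirr hψR hα2 hqa hβ2 hqb hanti hαskew hβskew (hψc α) (hψc β) hD hPm rfl hPirr hφ
    her).2 hnc
  have hW : weilClassesField S α P (2 * eigenMultiplicity S α ρ) ≤ hodgeClassSpan S.dim S.X (eigenMultiplicity S α ρ) :=
    weilClassesField_le_hodgeClassSpan_of_hasSemisimpleHodgeGroup hSS hPm rfl hPirr hφ her
  have hm0 : 2 * eigenMultiplicity S α ρ ≠ 0 := by
    intro h0
    rw [h0, mul_zero] at her
    omega
  have hWne : weilClassesField S α P (2 * eigenMultiplicity S α ρ) ≠ ⊥ := weilClassesField_ne_bot rfl hPirr hφ her hm0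
  by_contra hall
  push Not at hall
  have hB : hodgeClassSpan S.dim S.X (eigenMultiplicity S α ρ) ≤ divisorClassesSpan S.X S.dim (eigenMultiplicity S α ρ) :=
    Submodule.span_le.2 fun c hc ↦ hall _ c hc.1 hc.2
  have hle : weilClassesField S α P (2 * eigenMultiplicity S α ρ) ≤
      weilClassesField S α P (2 * eigenMultiplicity S α ρ) ⊓ divisorClassesSpan S.X S.dim (eigenMultiplicity S α ρ) :=
    le_inf le_rfl (hW.trans hB)
  rw [hbot, le_bot_iff] at hle
  exact hWne hle

/-- **`B•(S) ≠ D•(S)` FOR `S` OF TYPE III**: a complex abelian variety whose endomorphism algebra is a totally definite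
quaternion algebra over a number field is NOT divisor-generated (the tree's `IsDivisorGenerated` fails).
[cite: Murty1984, Main Theorem (via Gordon1999HodgeAVSurvey, Thm. 7.5 and §8.6 Theorem)]
[cite: MoonenZarhin1998WeilClasses, §1 Criterion (2), «Y is of Type 3, m = 1 and F ⊄ E»] -/
theorem not_isDivisorGenerated_of_isTotallyDefinite (hdef : IsTotallyDefinite K S.endAlgebra) :
    ¬ IsDivisorGenerated S := fun hD ↦ by
  obtain ⟨m, c, hcQ, hcH, hcD⟩ := exists_hodgeClass_not_mem_divisorClassesSpan_of_isTotallyDefinite S hdef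
  exact hcD (hD m c hcQ hcH)

/-- **MURTY: AN ABELIAN VARIETY OF TYPE III IS NOT STABLY NONDEGENERATE** (Gordon Thm. 7.5, (1) ⟹ (2): «`A` has
no factor of type (III)»), for `S` with `End⁰(S)` a totally definite quaternion algebra over a number field
(such an `S` is simple). [cite: Murty1984, Main Theorem (via Gordon1999HodgeAVSurvey, Thm. 7.5 and §8.6 Theorem)]
[cite: Gordon1999HodgeAVSurvey, Thm. 7.5 and Def. 7.6] -/
theorem not_isStablyNondegenerate_of_isTotallyDefinite (hdef : IsTotallyDefinite K S.endAlgebra) :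
    ¬ IsStablyNondegenerate S := fun h ↦
  not_isDivisorGenerated_of_isTotallyDefinite S hdef h.isDivisorGenerated

/-- **… NOR IS ANY `X` OF WHICH `S` IS A FACTOR UP TO ISOGENY** («if an abelian variety `A` has a factor of type
(III)»): if `t : S ⟶ X`, `h : X ⟶ S` with `t ≫ h = n • 𝟙 S`, `n ≠ 0`, then `X` is not divisor-generated (`B = D`
passes to such retracts, the tree's `IsDivisorGenerated.of_comp_eq_nsmul_id`).
[cite: Murty1984, Main Theorem (via Gordon1999HodgeAVSurvey, §8.6 Theorem)] [cite: Gordon1999HodgeAVSurvey, Rem. 7.6.1] -/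
theorem not_isDivisorGenerated_of_comp_eq_nsmul_id_of_isTotallyDefinite (hdef : IsTotallyDefinite K S.endAlgebra)
    {X : AbelianVariety ℂ} (t : S ⟶ X) (h : X ⟶ S) {n : ℕ} (hn : n ≠ 0) (hth : t ≫ h = n • 𝟙 S) :
    ¬ IsDivisorGenerated X := fun hX ↦
  not_isDivisorGenerated_of_isTotallyDefinite S hdef (IsDivisorGenerated.of_comp_eq_nsmul_id t h hn hth hX)

/-- In particular `S × B` and `B × S` are not divisor-generated, for every `B`.
[cite: Murty1984, Main Theorem (via Gordon1999HodgeAVSurvey, §8.6 Theorem)] -/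
theorem not_isDivisorGenerated_prod_of_isTotallyDefinite (hdef : IsTotallyDefinite K S.endAlgebra) (B : AbelianVariety ℂ) :
    ¬ IsDivisorGenerated (S.prod B) ∧ ¬ IsDivisorGenerated (B.prod S) :=
  ⟨not_isDivisorGenerated_of_comp_eq_nsmul_id_of_isTotallyDefinite S hdef (AbelianVariety.prodLift (𝟙 S) 0)
      (AbelianVariety.fst S B) one_ne_zero (by rw [AbelianVariety.prodLift_fst, one_smul]),
    not_isDivisorGenerated_of_comp_eq_nsmul_id_of_isTotallyDefinite S hdef (AbelianVariety.prodLift 0 (𝟙 S))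
      (AbelianVariety.snd B S) one_ne_zero (by rw [AbelianVariety.prodLift_snd, one_smul])⟩

/-- … and no `X` isogenous to `S × B` (or having `S` as a factor up to isogeny) is stably nondegenerate.
[cite: Murty1984, Main Theorem (via Gordon1999HodgeAVSurvey, Thm. 7.5 and §8.6 Theorem)] [cite: Gordon1999HodgeAVSurvey, Rem. 7.6.1] -/
theorem not_isStablyNondegenerate_of_isIsogenous_prod_of_isTotallyDefinite (hdef : IsTotallyDefinite K S.endAlgebra)
    {X B : AbelianVariety ℂ} (hX : AbelianVariety.IsIsogenous X (S.prod B)) : ¬ IsStablyNondegenerate X := fun h ↦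
  (not_isDivisorGenerated_prod_of_isTotallyDefinite S hdef B).1 (h.of_isIsogenous' hX).isDivisorGenerated

end TypeIII

/-! ### §4 Consequences: (D) forces type II among quaternion algebras; the type II product rows without `IsTotallyIndefinite` -/

section Consequences

variable {A S : AbelianVariety ℂ}

/-- **(D) + SIMPLE + QUATERNION `End⁰` + NO TYPE IV ⟹ TYPE II.**  For a simple complex abelian variety `S` whose
endomorphism algebra is a quaternion algebra over a number field `K`, with no factor of type IV, and which is
divisor-generated (`B•(S) = D•(S)`), `K` is totally real and `End⁰(S)` is TOTALLY INDEFINITE: the Rosati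
involution of a polarization is a positive anti-involution of the first kind, so Albert's dichotomy
(`isAlbertTypeII_or_isAlbertTypeIII_of_isPositiveAntiInvolution`) leaves types II and III, and type III is excluded
by `not_isDivisorGenerated_of_isTotallyDefinite`. [cite: Lange2023AbelianVarietiesComplex, §2.6.2 Thm. 2.6.5 (b), (c)]
[cite: MumfordAV1970, §21 Thm. 2] [cite: Murty1984, Main Theorem (via Gordon1999HodgeAVSurvey, Thm. 7.5 and §8.6 Theorem)] -/
theorem isTotallyIndefinite_of_isDivisorGenerated_of_hasNoTypeIVFactor {K : Type} [Field K] [NumberField K]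
    [Algebra K S.endAlgebra] [IsScalarTower ℚ K S.endAlgebra] [IsQuaternionAlgebra K S.endAlgebra]
    (hSs : S.IsSimple) (hIV : HasNoTypeIVFactor S) (hD : IsDivisorGenerated S) :
    IsTotallyReal K ∧ IsTotallyIndefinite K S.endAlgebra := by
  classical
  haveI : Module.Finite ℚ (bettiCohomology S.X 1) := finite_bettiCohomology_one S
  have hHD : exists_isReal_hodgeModel := exists_isReal_hodgeModel_holds
  have hI : hodgePQ_independent_of_hodgeModel := hodgePQ_independent_of_hodgeModel_holds
  haveI : HodgeTensorFacts.{0, 0} := hodgeTensorFacts_holds.{0, 0}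
  have hX : IsSmoothProjective S.dim S.X := AbelianVariety.isSmoothProjective_holds
  obtain ⟨ψ⟩ : (BettiUniverse.hodge hHD (AbelianVariety.isSmoothProjective_holds (A := S)) 1).IsPolarizable :=
    smoothProjective_hodgeStructure_isPolarizable_holds hX (BettiUniverse.realHodgeModel hHD hX)
      (BettiUniverse.realHodgeModel_isHodgeSymmetric hHD hX) 1
  have hdiv : ∀ x : S.endAlgebra, x ≠ 0 → IsUnit x := fun x hx ↦ (isUnit_or_eq_zero_of_isSimple hSs x).resolve_right hx
  have hpos := AbelianVariety.isPositiveAntiInvolution_rosati hHD hI ψ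
  have hfk := AbelianVariety.isOfFirstKind_rosati hHD hI ψ hIV (K := K)
  rcases isAlbertTypeII_or_isAlbertTypeIII_of_isPositiveAntiInvolution K hdiv hpos hfk with hII | hIII
  · exact ⟨hII.isTotallyReal, hII.isTotallyIndefinite⟩
  · exact absurd hD (not_isDivisorGenerated_of_isTotallyDefinite S hIII.isTotallyDefinite)

/-- **ANY stably nondegenerate `A` times a stably nondegenerate SIMPLE `S` with quaternion `End⁰(S)` over a number
field and no factor of type IV is stably nondegenerate** — the type II product row
`IsStablyNondegenerate.prod_of_isSimple_isTotallyIndefinite_right` with its hypotheses `IsTotallyReal K`,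
`IsTotallyIndefinite K End⁰(S)` DISCHARGED by §4 (they follow from `IsStablyNondegenerate S`).
[cite: Hazama1989, Thm. (= Gordon 7.6.2)] [cite: Gordon1999HodgeAVSurvey, Thm. 7.5 and 7.6.2]
[cite: Murty1984, Main Theorem (via Gordon1999HodgeAVSurvey, Thm. 7.5 and §8.6 Theorem)] -/
theorem IsStablyNondegenerate.prod_of_isSimple_quaternion_right (hA : IsStablyNondegenerate A) (hS : IsStablyNondegenerate S)
    {K : Type} [Field K] [NumberField K] [Algebra K S.endAlgebra] [IsScalarTower ℚ K S.endAlgebra]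
    [IsQuaternionAlgebra K S.endAlgebra] (hSs : S.IsSimple) (hIV : HasNoTypeIVFactor S) :
    IsStablyNondegenerate (A.prod S) := by
  obtain ⟨hK, hind⟩ := isTotallyIndefinite_of_isDivisorGenerated_of_hasNoTypeIVFactor (K := K) hSs hIV hS.isDivisorGenerated
  haveI := hK
  exact hA.prod_of_isSimple_isTotallyIndefinite_right hS hSs hind

/-- Left-handed form `S × A`. [cite: Hazama1989, Thm. (= Gordon 7.6.2)] [cite: Gordon1999HodgeAVSurvey, Thm. 7.5 and 7.6.2] -/
theorem IsStablyNondegenerate.prod_of_isSimple_quaternion_left (hA : IsStablyNondegenerate A) (hS : IsStablyNondegenerate S)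
    {K : Type} [Field K] [NumberField K] [Algebra K S.endAlgebra] [IsScalarTower ℚ K S.endAlgebra]
    [IsQuaternionAlgebra K S.endAlgebra] (hSs : S.IsSimple) (hIV : HasNoTypeIVFactor S) :
    IsStablyNondegenerate (S.prod A) := by
  obtain ⟨hK, hind⟩ := isTotallyIndefinite_of_isDivisorGenerated_of_hasNoTypeIVFactor (K := K) hSs hIV hS.isDivisorGenerated
  haveI := hK
  exact hA.prod_of_isSimple_isTotallyIndefinite_left hS hSs hind

/-- All mixed powers `A^{a+1} × S^{b+1}`. [cite: Hazama1989, Thm. (= Gordon 7.6.2)] [cite: Gordon1999HodgeAVSurvey, Rem. 7.6.1 and Thm. 7.6.2] -/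
theorem IsStablyNondegenerate.powSucc_prod_powSucc_of_isSimple_quaternion (hA : IsStablyNondegenerate A)
    (hS : IsStablyNondegenerate S) {K : Type} [Field K] [NumberField K] [Algebra K S.endAlgebra]
    [IsScalarTower ℚ K S.endAlgebra] [IsQuaternionAlgebra K S.endAlgebra] (hSs : S.IsSimple) (hIV : HasNoTypeIVFactor S)
    (a b : ℕ) : IsStablyNondegenerate ((A.powSucc a).prod (S.powSucc b)) := by
  obtain ⟨hK, hind⟩ := isTotallyIndefinite_of_isDivisorGenerated_of_hasNoTypeIVFactor (K := K) hSs hIV hS.isDivisorGenerated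
  haveI := hK
  exact hA.powSucc_prod_powSucc_of_isSimple_isTotallyIndefinite_right hS hSs hind a b

end Consequences

end Literature.AlgebraicGeometry.HodgeTheory

end
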